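import Summits.RiemannHypothesis.RiemannHypothesis.Theorems.WeilFormatCWindowDictionary
import Literature.NumberTheory.LFunctions.WeilMarkovQuadraticChar
import HarnessLib

/-!
# GRH arm (rh-explicit, venture WeilGRH): the twisted window form of `L(s, χ)` and its dictionary —
  positivity on the trigonometric windows `Σ_{|n| ≤ N} c_n χ_n` implies `WeilPositivityOnChar χ a`

Cell `rh-explicit`, WEIL TRACK — GRH ARM (typing seat weil-grh-1).  The `χ`-twisted analogue of the
format-C dictionary `WeilFormatCWindowDictionary.lean` (`weilPositivityOn_of_weilWindowForm_sum_chi_nonneg`).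

For a Dirichlet character `χ` mod `q ≠ 1` the twisted Markov decomposition
(`Literature/…/WeilMarkovQuadraticChar.lean`, `re_weilQuadraticChar_eq_markov_of_ne_one`) reads, for
test functions `g` supported in `[-a, a]`,

  `Re Q_χ(g) = 𝓔^χ_a(g) − M^χ_a ‖g‖₂²`,

`𝓔^χ_a(u) = Σ_{log n < 2a} Λ(n) n^{-1/2} D^{χ̄(n)}_{log n}(u) + ∫₀^∞ e^{(1/2−κ)t}/(2 sinh t) D_t(u) dt`
(`weilDirichletEnergyChar`; twisted increments `D^ω_t(u) = ∫|u(x+t) − ωu(x)|²dx`, parity `κ = a_χ`) and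
`M^χ_a = weilMarkovConstantChar χ a`.  The right-hand side — the **twisted window form** — makes sense
for every WINDOW FUNCTION `u` (measurable, `0` off `[-a,a]`, bounded, Lipschitz on the closed window:
trigonometric windows `Σ c_n χ_n`, truncated Fourier series, Yoshida's `K(a)`), and this file proves:

* `tendsto_weilTwistIncrement_of_uniform`: `D^ω_t(u_N) → D^ω_t(φ)` along a uniformly convergent,
  uniformly bounded window family (dominated convergence, as `tendsto_weilIncrement_of_uniform`);
* `tendsto_twistedWindowForm_of_uniform`: `𝓔^χ_a(u_N) − M^χ_a‖u_N‖₂² → 𝓔^χ_a(φ) − M^χ_a‖φ‖₂²` along a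
  uniformly convergent window family with uniform sup and Lipschitz bounds — the archimedean part by
  dominated convergence in `t` with the format-C majorant `integrableOn_archBound`, which dominates the
  parity-`κ` density as well (`e^{(1/2−κ)t} ≤ e^{t/2}`);
* `tendsto_twistedWindowForm_proj`: continuity along Fourier truncation `proj a N φ` on Yoshida's `K(a)`;
* **the dictionary** `weilPositivityOnChar_of_twistedWindowForm_sum_chi_nonneg`: if `q ≠ 1`, `a > 0`
  and `𝓔^χ_a(Σ_{|n|≤N} c_nχ_n) − M^χ_a‖Σ_{|n|≤N} c_nχ_n‖₂² ≥ 0` for every `N` and every `c : ℤ → ℂ`, then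
  `WeilPositivityOnChar χ a` — the entry point through which a finite hermitian-matrix certificate for
  `L(s, χ)` on the window (the cell's `χ`-twisted Fourier–Galerkin / K(t)-closure certificates,
  EXTREMALS/GRH) becomes a kernel-checked rung of the GRH arm.

No new definitions (the form is written out); no named facts; RH/GRH-free.  The Gram expansion of the
twisted form on the `χ_n` (matrix entries) is not in this file.
-/

set_option autoImplicit false

noncomputable section

open Complex Filter Set MeasureTheory
open scoped Real Topology ComplexConjugate ArithmeticFunction.vonMangoldt

namespace Summit.Ventures.WeilGRH

open Literature.NumberTheory.LFunctions
open Literature.NumberTheory.LFunctions.Yoshida1992 (modes chi proj trigPoly trigPolyDeriv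
  proj_apply_of_mem proj_apply_of_not_mem proj_apply_eq_indicator_trigPoly norm_trigPoly_le
  norm_trigPoly_sub_le norm_trigPolyDeriv_le norm_sub_trigPoly_le tendsto_tsum_compl_modes
  summable_pow_mul_norm_fourierCoeff)
open Summit.RiemannHypothesis.RiemannHypothesis.Theorems.WeilFormatC

variable {q : ℕ} {a : ℝ} {φ : ℝ → ℂ} {u : ℕ → ℝ → ℂ} {S₀ S₁ : ℝ} {δ : ℕ → ℝ}

/-! ## Twisted increments along uniformly convergent window families -/

/-- Crude pointwise bound for the twisted increment integrand of a bounded function vanishing off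
`[-a,a]`: `‖u(x+t) − ω u(x)‖² ≤ 2S₀²(𝟙_{[-a,a]}(x+t) + ‖ω‖² 𝟙_{[-a,a]}(x))`. -/
private theorem norm_sub_twist_sq_le_window_bound {v : ℝ → ℂ} (hz : ∀ x, x ∉ Icc (-a) a → v x = 0)
    (hb : ∀ x, ‖v x‖ ≤ S₀) (ω : ℂ) (t x : ℝ) :
    ‖v (x + t) - ω * v x‖ ^ 2 ≤
      2 * S₀ ^ 2 * ((Icc (-a) a).indicator 1 (x + t) + ‖ω‖ ^ 2 * (Icc (-a) a).indicator 1 x) := by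
  have hS₀ : 0 ≤ S₀ := (norm_nonneg _).trans (hb 0)
  have key : ∀ y, ‖v y‖ ^ 2 ≤ S₀ ^ 2 * (Icc (-a) a).indicator 1 y := by
    intro y
    by_cases hy : y ∈ Icc (-a) a
    · rw [indicator_of_mem hy, Pi.one_apply, mul_one]
      have := hb y
      have h0 : 0 ≤ ‖v y‖ := norm_nonneg _
      nlinarith
    · rw [hz y hy, indicator_of_notMem hy, norm_zero, mul_zero]
      simp
  have htri : ‖v (x + t) - ω * v x‖ ^ 2 ≤ 2 * ‖v (x + t)‖ ^ 2 + 2 * (‖ω‖ ^ 2 * ‖v x‖ ^ 2) := by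
    have h := norm_sub_le (v (x + t)) (ω * v x)
    rw [norm_mul] at h
    have h0 : 0 ≤ ‖v (x + t) - ω * v x‖ := norm_nonneg _
    nlinarith [sq_nonneg (‖v (x + t)‖ - ‖ω‖ * ‖v x‖), norm_nonneg ω, norm_nonneg (v x)]
  have k1 := key (x + t)
  have k2 := mul_le_mul_of_nonneg_left (key x) (sq_nonneg ‖ω‖)
  nlinarith

/-- **`D^ω_t(u_N) → D^ω_t(φ)`** along a window family: `u_N` measurable, `0` off `[-a,a]`,
`‖u_N‖ ≤ S₀`, `‖u_N − φ‖_∞ ≤ δ_N → 0` (dominated convergence on the window). -/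
theorem tendsto_weilTwistIncrement_of_uniform (hum : ∀ N, Measurable (u N))
    (huz : ∀ N x, x ∉ Icc (-a) a → u N x = 0)
    (hub : ∀ N x, ‖u N x‖ ≤ S₀) (hnear : ∀ N x, ‖u N x - φ x‖ ≤ δ N)
    (hδ : Tendsto δ atTop (𝓝 0)) (ω : ℂ) (t : ℝ) :
    Tendsto (fun N ↦ weilTwistIncrement ω (u N) t) atTop (𝓝 (weilTwistIncrement ω φ t)) := by
  have hpt : ∀ y, Tendsto (fun N ↦ u N y) atTop (𝓝 (φ y)) := by
    intro y
    rw [tendsto_iff_norm_sub_tendsto_zero]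
    exact squeeze_zero (fun N ↦ norm_nonneg _) (fun N ↦ hnear N y) hδ
  unfold weilTwistIncrement
  refine tendsto_integral_of_dominated_convergence
    (fun x ↦ 2 * S₀ ^ 2 * ((Icc (-a) a).indicator 1 (x + t) + ‖ω‖ ^ 2 * (Icc (-a) a).indicator 1 x))
    (fun N ↦ ((((hum N).comp (measurable_id.add_const t)).sub ((hum N).const_mul ω)).norm.pow_const 2
      |>.aestronglyMeasurable)) ?_ (fun N ↦ Eventually.of_forall fun x ↦ ?_)
    (Eventually.of_forall fun x ↦ ?_)
  · refine Integrable.const_mul (Integrable.add ?_ ?_) _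
    · exact ((integrable_indicator_iff measurableSet_Icc).2
        (integrableOn_const (by simp [Real.volume_Icc]))).comp_add_right t
    · exact ((integrable_indicator_iff measurableSet_Icc).2
        (integrableOn_const (by simp [Real.volume_Icc]))).const_mul _
  · rw [Real.norm_of_nonneg (by positivity)]
    exact norm_sub_twist_sq_le_window_bound (huz N) (hub N) ω t x
  · exact (((hpt (x + t)).sub ((hpt x).const_mul ω)).norm).pow 2

/-! ## The archimedean part with parity -/

/-- The parity-`κ` archimedean density is measurable. -/
theorem measurable_weilArchDensityPar (κ : ℕ) : Measurable (weilArchDensityPar κ) :=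
  (by fun_prop : Continuous fun t : ℝ ↦ Real.exp ((1 / 2 - κ) * t)).measurable.div
    (by fun_prop : Continuous fun t : ℝ ↦ 2 * Real.sinh t).measurable

/-- `0 ≤ ρ_κ(t) ≤ ρ_0(t) = weilArchDensity t` for `t > 0` (the parity lowers the density). -/
theorem weilArchDensityPar_nonneg_le (κ : ℕ) {t : ℝ} (ht : 0 < t) :
    0 ≤ weilArchDensityPar κ t ∧ weilArchDensityPar κ t ≤ weilArchDensity t := by
  have h2s : 0 < 2 * Real.sinh t := mul_pos two_pos (Real.sinh_pos_iff.2 ht)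
  refine ⟨div_nonneg (Real.exp_pos _).le h2s.le, ?_⟩
  unfold weilArchDensityPar weilArchDensity
  refine div_le_div_of_nonneg_right (Real.exp_le_exp.2 ?_) h2s.le
  have hκ : (0 : ℝ) ≤ κ := κ.cast_nonneg
  nlinarith

/-- **The twisted archimedean energy converges along a window family** with uniform sup AND
Lipschitz bounds: `∫₀^∞ ρ_κ(t) D_t(u_N) dt → ∫₀^∞ ρ_κ(t) D_t(φ) dt` (dominated convergence in `t` with
the format-C majorant `integrableOn_archBound`, valid since `ρ_κ ≤ ρ_0`). -/
theorem tendsto_archIntegralPar_of_uniform (ha : 0 < a) (hum : ∀ N, Measurable (u N))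
    (huz : ∀ N x, x ∉ Icc (-a) a → u N x = 0) (hub : ∀ N x, ‖u N x‖ ≤ S₀)
    (hul : ∀ N x y, x ∈ Icc (-a) a → y ∈ Icc (-a) a → ‖u N y - u N x‖ ≤ S₁ * |y - x|)
    (hnear : ∀ N x, ‖u N x - φ x‖ ≤ δ N) (hδ : Tendsto δ atTop (𝓝 0)) (κ : ℕ) :
    Tendsto (fun N ↦ ∫ t in Ioi (0 : ℝ), weilArchDensityPar κ t * weilIncrement (u N) t) atTop
      (𝓝 (∫ t in Ioi (0 : ℝ), weilArchDensityPar κ t * weilIncrement φ t)) := by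
  have hinc : ∀ t, Tendsto (fun N ↦ weilIncrement (u N) t) atTop (𝓝 (weilIncrement φ t)) :=
    tendsto_weilIncrement_of_uniform hum huz hub hnear hδ
  refine tendsto_integral_of_dominated_convergence
    (fun t ↦ weilArchDensity t * (if t ≤ 1 then (2 * a * S₁ ^ 2 + 2 * S₀ ^ 2) * t else 8 * a * S₀ ^ 2))
    (fun N ↦ ((measurable_weilArchDensityPar κ).mul (measurable_weilIncrement (hum N))).aestronglyMeasurable)
    (integrableOn_archBound ha.le S₀ S₁) (fun N ↦ ?_)
    (Eventually.of_forall fun t ↦ (hinc t).const_mul _)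
  refine (ae_restrict_iff' measurableSet_Ioi).2 (Eventually.of_forall fun t ht ↦ ?_)
  obtain ⟨h0, hle⟩ := weilArchDensityPar_nonneg_le κ ht
  have hD : 0 ≤ weilIncrement (u N) t := weilIncrement_nonneg _ _
  rw [Real.norm_of_nonneg (mul_nonneg h0 hD)]
  exact (mul_le_mul_of_nonneg_right hle hD).trans
    (weilArchDensity_mul_weilIncrement_le_archBound ha.le (hum N) (huz N) (hub N) (hul N) ht)

/-! ## Continuity of the twisted window form along window families -/

/-- **Continuity of the twisted window form along a uniformly convergent window family.**  Let
`a > 0`, `χ` a Dirichlet character mod `q`, `u_N` measurable, `0` off `[-a,a]`, `‖u_N‖ ≤ S₀`,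
`S₁`-Lipschitz on the closed window, `‖u_N − φ‖_∞ ≤ δ_N → 0`.  Then
`𝓔^χ_a(u_N) − M^χ_a‖u_N‖₂² → 𝓔^χ_a(φ) − M^χ_a‖φ‖₂²`. -/
theorem tendsto_twistedWindowForm_of_uniform (χ : DirichletCharacter ℂ q) (ha : 0 < a)
    (hum : ∀ N, Measurable (u N))
    (huz : ∀ N x, x ∉ Icc (-a) a → u N x = 0) (hub : ∀ N x, ‖u N x‖ ≤ S₀)
    (hul : ∀ N x y, x ∈ Icc (-a) a → y ∈ Icc (-a) a → ‖u N y - u N x‖ ≤ S₁ * |y - x|)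
    (hnear : ∀ N x, ‖u N x - φ x‖ ≤ δ N) (hδ : Tendsto δ atTop (𝓝 0)) :
    Tendsto (fun N ↦ weilDirichletEnergyChar χ a (u N) -
        weilMarkovConstantChar χ a * ∫ x : ℝ, ‖u N x‖ ^ 2) atTop
      (𝓝 (weilDirichletEnergyChar χ a φ - weilMarkovConstantChar χ a * ∫ x : ℝ, ‖φ x‖ ^ 2)) := by
  have htw : ∀ (ω : ℂ) (t : ℝ),
      Tendsto (fun N ↦ weilTwistIncrement ω (u N) t) atTop (𝓝 (weilTwistIncrement ω φ t)) :=
    tendsto_weilTwistIncrement_of_uniform hum huz hub hnear hδ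
  have hprime : Tendsto (fun N ↦ ∑ n ∈ weilPrimeIndex a, (Λ n : ℝ) / Real.sqrt n *
      weilTwistIncrement (conj (χ (n : ZMod q))) (u N) (Real.log n)) atTop
      (𝓝 (∑ n ∈ weilPrimeIndex a, (Λ n : ℝ) / Real.sqrt n *
        weilTwistIncrement (conj (χ (n : ZMod q))) φ (Real.log n))) :=
    tendsto_finsetSum _ fun n _ ↦ (htw _ _).const_mul _
  have harch := tendsto_archIntegralPar_of_uniform ha hum huz hub hul hnear hδ (charParity χ)
  have hnorm := tendsto_integral_norm_sq_of_uniform hum huz hub hnear hδ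
  unfold weilDirichletEnergyChar
  exact (hprime.add harch).sub (hnorm.const_mul _)

/-- **Continuity along Fourier truncation on Yoshida's `K(a)`**: for `φ ∈ K(a)` (`a > 0`),
`𝓔^χ_a(proj a N φ) − M^χ_a‖proj a N φ‖₂² → 𝓔^χ_a(φ) − M^χ_a‖φ‖₂²` (the truncated Fourier series is a
window family: `tendsto_weilWindowForm_proj`'s bookkeeping verbatim). -/
theorem tendsto_twistedWindowForm_proj (χ : DirichletCharacter ℂ q) (ha : 0 < a)
    (hφ : φ ∈ Yoshida1992.K a) :
    Tendsto (fun N ↦ weilDirichletEnergyChar χ a (proj a N φ) -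
        weilMarkovConstantChar χ a * ∫ x : ℝ, ‖proj a N φ x‖ ^ 2) atTop
      (𝓝 (weilDirichletEnergyChar χ a φ - weilMarkovConstantChar χ a * ∫ x : ℝ, ‖φ x‖ ^ 2)) := by
  have hsum0 : Summable fun n : ℤ ↦ ‖Yoshida1992.fourierCoeff a n φ‖ := by
    simpa using summable_pow_mul_norm_fourierCoeff ha hφ 0
  have hsum1 := summable_pow_mul_norm_fourierCoeff ha hφ 1
  have hcont : ∀ N, Continuous (trigPoly a N φ) := fun N ↦
    continuous_finsetSum _ fun n _ ↦ continuous_const.mul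
      (Complex.continuous_exp.comp ((continuous_const.mul Complex.continuous_ofReal).div_const _))
  refine tendsto_twistedWindowForm_of_uniform χ (u := fun N ↦ proj a N φ)
    (S₀ := ∑' n : ℤ, ‖Yoshida1992.fourierCoeff a n φ‖ / (2 * a))
    (S₁ := (π / a / (2 * a)) * ∑' n : ℤ, |(n : ℝ)| ^ 1 * ‖Yoshida1992.fourierCoeff a n φ‖)
    (δ := fun N ↦ ∑' n : {n // n ∉ modes N}, ‖Yoshida1992.fourierCoeff a n φ‖ / (2 * a))
    ha (fun N ↦ ?_) (fun N x hx ↦ proj_apply_of_not_mem ha N φ hx) (fun N x ↦ ?_)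
    (fun N x y hx hy ↦ ?_) (fun N x ↦ ?_) (tendsto_tsum_compl_modes a φ)
  · have : proj a N φ = (Icc (-a) a).indicator (trigPoly a N φ) :=
      funext fun x ↦ proj_apply_eq_indicator_trigPoly ha N φ x
    rw [this]
    exact (hcont N).measurable.indicator measurableSet_Icc
  · by_cases hx : x ∈ Icc (-a) a
    · rw [proj_apply_of_mem ha N φ hx]
      exact norm_trigPoly_le ha hsum0 N x
    · rw [proj_apply_of_not_mem ha N φ hx, norm_zero]
      exact tsum_nonneg fun n ↦ by positivity
  · rw [proj_apply_of_mem ha N φ hx, proj_apply_of_mem ha N φ hy]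
    exact norm_trigPoly_sub_le (fun z ↦ norm_trigPolyDeriv_le ha hsum1 N z) x y
  · by_cases hx : x ∈ Icc (-a) a
    · rw [proj_apply_of_mem ha N φ hx, norm_sub_rev]
      exact norm_sub_trigPoly_le ha hφ N hx
    · rw [proj_apply_of_not_mem ha N φ hx,
        Yoshida1992.eq_zero_of_mem_K hφ (lt_abs_of_not_mem_Icc_window hx), sub_zero, norm_zero]
      exact tsum_nonneg fun n ↦ by positivity

/-- **Positivity on the trigonometric windows implies positivity of the twisted window form on all of
`K(a)`** (`a > 0`). -/
theorem twistedWindowForm_nonneg_of_mem_K (χ : DirichletCharacter ℂ q) (ha : 0 < a)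
    (h : ∀ (N : ℕ) (c : ℤ → ℂ),
      0 ≤ weilDirichletEnergyChar χ a (∑ n ∈ modes N, c n • chi a n) -
        weilMarkovConstantChar χ a * ∫ x : ℝ, ‖(∑ n ∈ modes N, c n • chi a n) x‖ ^ 2)
    (hφ : φ ∈ Yoshida1992.K a) :
    0 ≤ weilDirichletEnergyChar χ a φ - weilMarkovConstantChar χ a * ∫ x : ℝ, ‖φ x‖ ^ 2 :=
  ge_of_tendsto' (tendsto_twistedWindowForm_proj χ ha hφ) fun N ↦
    h N fun n ↦ (((1 / Real.sqrt (2 * a) : ℝ) : ℂ) * Yoshida1992.fourierCoeff a n φ)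

/-- **THE DICTIONARY (twisted Fourier–Galerkin certificate ⟹ a rung of the GRH arm).**  Let `χ` be a
Dirichlet character mod `q ≠ 1` and `a > 0`.  If the twisted window form is non-negative on every
trigonometric window, `𝓔^χ_a(Σ_{|n| ≤ N} c_n χ_n) − M^χ_a ‖Σ_{|n| ≤ N} c_n χ_n‖₂² ≥ 0` for all `N` and all
`c : ℤ → ℂ` (`χ_n = chi a n = (2a)^{-1/2} e^{iπnx/a}𝟙_{[-a,a]}`), then `WeilPositivityOnChar χ a`: every
smooth `g` supported in `[-a, a]` has `Re Q_χ(g) ≥ 0`.  Proof: `g ∈ C(a) ⊂ K(a)` and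
`Re Q_χ(g) = 𝓔^χ_a(g) − M^χ_a‖g‖₂²` (`re_weilQuadraticChar_eq_markov_of_ne_one`). -/
theorem weilPositivityOnChar_of_twistedWindowForm_sum_chi_nonneg (hq : q ≠ 1)
    (χ : DirichletCharacter ℂ q) (ha : 0 < a)
    (h : ∀ (N : ℕ) (c : ℤ → ℂ),
      0 ≤ weilDirichletEnergyChar χ a (∑ n ∈ modes N, c n • chi a n) -
        weilMarkovConstantChar χ a * ∫ x : ℝ, ‖(∑ n ∈ modes N, c n • chi a n) x‖ ^ 2) :
    WeilPositivityOnChar χ a := by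
  intro g hg hsupp
  rw [re_weilQuadraticChar_eq_markov_of_ne_one hq χ hg hsupp]
  exact twistedWindowForm_nonneg_of_mem_K χ ha h (Yoshida1992.C_le_K ha ⟨hg, hsupp⟩)

end Summit.Ventures.WeilGRH

end
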